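import Mathlib
import HarnessLib
import Summits.HubbardSuperconductivity.HubbardSuperconductivity.Theorems.KLProgrammeC4aPartnerBandMixedJetCeiling

/-!
# Route `KLProgramme` — crux C4a, S3 brick (B4, DIRECT SHEET): UNIFORM JET TABLES of the pp partner band in the base angle and the first mixed loop-angle derivative —
# `|∂ᵐ_ψ ē(e,φ;ρ,ϑ)| ≤ m!·𝒦·Dᵐ`, `|∂_φ ∂ᵐ_ψ ē| ≤ (m+1)!·𝒦·D^{m+1}` at EVERY configuration (the `H₀`, `H₁` rows of the transversal two-zero control)

Cell `gate-hubbard-kl`, seat hubbard-kl-k3c3-p3 (g25; row «implicit-function / monotonicity route for μ(n)»).  Located brick «(B4)-DIRECT-COUNT» (memo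
HOME/hubbard-kl-k3c3-p3/B4-DIRECT-COUNT.md §1 (iii)–(iv)): the ceilings `H₀ = sup|h|`, `H₁ = sup|h′|` of `…C4aTransversalZeroControl.abs_le_mul_abs_of_transversal_zeros(_deriv)` for the jet
profiles `h = ∂ᵐ_ψ|_θ ē(e,·;ρ,ϑ)`, at every configuration `(ρ, ϑ)` and loop level `e` in the tube, from the frame tables — the same plane calculus as
`…C4aPartnerBandMixedJetCeiling` (nested directional derivatives = the Fréchet derivative on the direction tuple) for the general configuration map
`P_{ρ,e}(φ,ψ) := Φ(0,ψ) + Φ(ρ,ϑ+ψ) − Φ(e,φ+ψ)`: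

* §1 (generic) `norm_iteratedDeriv_section_snd_le` (`‖∂ᵐ_t G(s,t)‖ ≤ ‖DᵐG(s,t)‖`), `norm_deriv_iteratedDeriv_section_le` (`‖∂_s∂ᵐ_t G(s,t)‖ ≤ ‖D^{m+1}G(s,t)‖`);
* §2 rows of `P_{ρ,e}`: `norm_iteratedFDeriv_levelPoint_level_comp_affine_le` (`‖Dⁱ(q ↦ Φ_x(c + Lq))‖ ≤ msD6 i·‖L‖ⁱ`, `|x| < r`), `norm_iteratedFDeriv_pairConfigLevel_le`
  (`‖DⁱP_{ρ,e}‖ ≤ (2 + 2ⁱ)·msD6 i`), `norm_iteratedFDeriv_partnerBandLevel_plane_le` (`‖Dⁿ(e_K ∘ P_{ρ,e})‖ ≤ n!·𝒦·Dⁿ`);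
* §3 **`abs_iteratedDeriv_partnerBand_pp_base_le_table`** (`|∂ᵐ_ψ|_θ e_K(Φ(0,ψ) + Φ(ρ,ϑ+ψ) − Φ(e,φ+ψ))| ≤ m!·𝒦·Dᵐ`, `m ≤ 6`) and
  **`abs_deriv_iteratedDeriv_partnerBand_pp_base_le_table`** (`|∂_φ ∂ᵐ_ψ|_θ …| ≤ (m+1)!·𝒦·D^{m+1}`, `m ≤ 5`).

Binder shape = `…C4aPathJetsSix`.  Pure calculus on landed objects; nothing about the model's sizes; nothing asserts (C), K3 or superconductivity.
References: FST II CPAM 51 (1998) §3; BGM 2006 §2.4 [cite: BenfattoGiulianiMastropietro2006].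
-/

noncomputable section

namespace Summit.HubbardSuperconductivity.HubbardSuperconductivity.Theorems.C4a

set_option linter.dupNamespace false -- summit = problem name (single-conjunct summit), D-0017

open Real Set Filter
open scoped Topology ContDiff
open Literature.MathematicalPhysics.QuantumLattice Literature.MathematicalPhysics.QuantumLattice.BandSectorCounting Literature.Probability.LatticeModels
open Summit.HubbardSuperconductivity.HubbardSuperconductivity.Theorems.KLRegimeSplit
open Summit.HubbardSuperconductivity.HubbardSuperconductivity.Theorems.DispersionFlow
open Summit.HubbardSuperconductivity.HubbardSuperconductivity.Theorems.PerturbedFermiCurve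

/-! ## §1 Sections and one mixed derivative against the Fréchet derivative (generic) -/

section Generic

variable {F : Type*} [NormedAddCommGroup F] [NormedSpace ℝ F]

/-- **`‖∂ᵐ_t G(s,t)‖ ≤ ‖DᵐG(s,t)‖`** for `G : ℝ × ℝ → F` smooth (sup norm on the plane). -/
theorem norm_iteratedDeriv_section_snd_le {G : ℝ × ℝ → F} (hG : ContDiff ℝ ∞ G) (m : ℕ) (s t : ℝ) :
    ‖iteratedDeriv m (fun t : ℝ => G (s, t)) t‖ ≤ ‖iteratedFDeriv ℝ m G (s, t)‖ := by
  rw [iteratedDeriv_section_snd_eq_iterate m hG s t, iterate_fderiv_apply_eq_iteratedFDeriv hG _ m]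
  refine (ContinuousMultilinearMap.le_opNorm _ _).trans ?_
  have h1 : ∀ i : Fin m, ‖(fun _ : Fin m => (((0 : ℝ), (1 : ℝ)) : ℝ × ℝ)) i‖ = 1 := fun i => by simp [Prod.norm_def]
  rw [Finset.prod_congr rfl fun i _ => h1 i, Finset.prod_const_one, mul_one]

/-- **`‖∂_s ∂ᵐ_t G(s,t)‖ ≤ ‖D^{m+1}G(s,t)‖`** for `G : ℝ × ℝ → F` smooth. -/
theorem norm_deriv_iteratedDeriv_section_le {G : ℝ × ℝ → F} (hG : ContDiff ℝ ∞ G) (m : ℕ) (s t : ℝ) :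
    ‖deriv (fun s : ℝ => iteratedDeriv m (fun t : ℝ => G (s, t)) t) s‖ ≤ ‖iteratedFDeriv ℝ (m + 1) G (s, t)‖ := by
  set e₁ : ℝ × ℝ := ((1 : ℝ), (0 : ℝ)) with he₁
  set e₂ : ℝ × ℝ := ((0 : ℝ), (1 : ℝ)) with he₂
  have hinner : (fun s : ℝ => iteratedDeriv m (fun t : ℝ => G (s, t)) t) =
      fun s : ℝ => (fun q : ℝ × ℝ => iteratedFDeriv ℝ m G q (fun _ : Fin m => e₂)) (s, t) := by
    funext s
    rw [iteratedDeriv_section_snd_eq_iterate m hG s t, iterate_fderiv_apply_eq_iteratedFDeriv hG e₂ m]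
  have hH : ContDiff ℝ ∞ (fun q : ℝ × ℝ => iteratedFDeriv ℝ m G q (fun _ : Fin m => e₂)) := contDiff_iteratedFDeriv_apply_const hG m _
  rw [hinner, deriv_section_fst_eq_fderiv hH s t, fderiv_iteratedFDeriv_apply_eq_cons hG m _ (s, t) e₁]
  refine (ContinuousMultilinearMap.le_opNorm _ _).trans ?_
  have hnorm : ∀ i : Fin (m + 1), ‖(Fin.cons e₁ (fun _ : Fin m => e₂) : Fin (m + 1) → ℝ × ℝ) i‖ = 1 := by
    intro i
    refine Fin.cases ?_ (fun j => ?_) i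
    · simp [he₁, Prod.norm_def]
    · simp [he₂, Prod.norm_def]
  rw [Finset.prod_congr rfl fun i _ => hnorm i, Finset.prod_const_one, mul_one]

end Generic

/-! ## §2 The general configuration map `P_{ρ,e}(φ,ψ) = Φ(0,ψ) + Φ(ρ,ϑ+ψ) − Φ(e,φ+ψ)` -/

section Sizes

variable {K : TrigPolyC4v} {A : ℝ} (hA : ∀ p : Momentum, ∀ j ≤ 2, ‖iteratedFDeriv ℝ j (frameShift K) p‖ ≤ A) (hA20 : A ≤ 1 / 20)
  (hd : klCurveD ≤ (bandBounds (show (-4 : ℝ) < -1.1 by norm_num) (show (-1.1 : ℝ) ≤ -0.1 by norm_num)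
    (show (-0.1 : ℝ) < 0 by norm_num)).Dtmin - 2 * A)
  {μ r : ℝ} (hr : 0 < r) (hlo : (-1.1 : ℝ) < μ - r - A) (hhi : μ + r + A < -0.1)
  {A₃ A₄ A₅ A₆ : ℝ} (hA₃ : ∀ p : Momentum, ‖iteratedFDeriv ℝ 3 (frameShift K) p‖ ≤ A₃)
  (hA₄ : ∀ p : Momentum, ‖iteratedFDeriv ℝ 4 (frameShift K) p‖ ≤ A₄)
  (hA₅ : ∀ p : Momentum, ‖iteratedFDeriv ℝ 5 (frameShift K) p‖ ≤ A₅)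
  (hA₆ : ∀ p : Momentum, ‖iteratedFDeriv ℝ 6 (frameShift K) p‖ ≤ A₆)
include hA hA20 hd hr hlo hhi hA₃ hA₄ hA₅ hA₆

omit hA20 hr hA₃ hA₄ hA₅ hA₆ in
/-- The chart curve at any level of the tube is `C^∞`. -/
theorem contDiff_levelPoint_top {x : ℝ} (hx : |x| < r) : ContDiff ℝ ∞ (levelPoint μ K x) :=
  contDiff_infty.2 fun i => contDiff_levelPoint_of_sizes hA hd hlo hhi hx i

omit hr in
/-- **One chart term at level `x` along an affine map of the plane**: `‖Dⁱ(q ↦ Φ_x(c + L q))(q)‖ ≤ msD6 i·‖L‖ⁱ` (`1 ≤ i ≤ 6`, `|x| < r`). -/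
theorem norm_iteratedFDeriv_levelPoint_level_comp_affine_le {x : ℝ} (hx : |x| < r) (c : ℝ) (L : ℝ × ℝ →L[ℝ] ℝ) {i : ℕ} (hi1 : 1 ≤ i) (hi6 : i ≤ 6)
    (q : ℝ × ℝ) :
    ‖iteratedFDeriv ℝ i (fun q : ℝ × ℝ => levelPoint μ K x (c + L q)) q‖ ≤ msD6 A₃ A₄ A₅ A₆ i * ‖L‖ ^ i := by
  have hΦ : ContDiff ℝ ∞ (levelPoint μ K x) := contDiff_levelPoint_top hA hd hlo hhi hx
  have hΦc : ContDiff ℝ ∞ (fun z : ℝ => levelPoint μ K x (c + z)) := hΦ.comp (contDiff_const.add contDiff_id)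
  have hfun : (fun q : ℝ × ℝ => levelPoint μ K x (c + L q)) = (fun z : ℝ => levelPoint μ K x (c + z)) ∘ L := rfl
  rw [hfun, ContinuousLinearMap.iteratedFDeriv_comp_right L hΦc q (by exact_mod_cast le_top), iteratedFDeriv_comp_add_left]
  refine (ContinuousMultilinearMap.norm_compContinuousLinearMap_le _ _).trans ?_
  rw [Finset.prod_const, Finset.card_univ, Fintype.card_fin, norm_iteratedFDeriv_eq_norm_iteratedDeriv]
  exact mul_le_mul_of_nonneg_right (norm_iteratedDeriv_levelPoint_le_six hA hA20 hd hlo hhi hA₃ hA₄ hA₅ hA₆ hx hi1 hi6 _) (by positivity)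

/-- **Derivative rows of `P_{ρ,e}`**: `‖DⁱP_{ρ,e}(q)‖ ≤ (2 + 2ⁱ)·msD6 i` for `1 ≤ i ≤ 6`, `|ρ|, |e| < r`. -/
theorem norm_iteratedFDeriv_pairConfigLevel_le {ρ e : ℝ} (hρ : |ρ| < r) (he : |e| < r) (ϑ : ℝ) {i : ℕ} (hi1 : 1 ≤ i) (hi6 : i ≤ 6) (q : ℝ × ℝ) :
    ‖iteratedFDeriv ℝ i (fun q : ℝ × ℝ => levelPoint μ K 0 q.2 + levelPoint μ K ρ (ϑ + q.2) - levelPoint μ K e (q.1 + q.2)) q‖ ≤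
      (2 + 2 ^ i) * msD6 A₃ A₄ A₅ A₆ i := by
  have h0 : |(0 : ℝ)| < r := by simpa using hr
  set L₂ : ℝ × ℝ →L[ℝ] ℝ := ContinuousLinearMap.snd ℝ ℝ ℝ with hL₂
  set L₁₂ : ℝ × ℝ →L[ℝ] ℝ := ContinuousLinearMap.fst ℝ ℝ ℝ + ContinuousLinearMap.snd ℝ ℝ ℝ with hL₁₂
  have hn₂ : ‖L₂‖ ≤ 1 := ContinuousLinearMap.norm_snd_le ℝ ℝ ℝ
  have hn₁₂ : ‖L₁₂‖ ≤ 2 := by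
    refine (norm_add_le _ _).trans ?_
    have := ContinuousLinearMap.norm_fst_le ℝ ℝ ℝ
    have := ContinuousLinearMap.norm_snd_le ℝ ℝ ℝ
    linarith
  have e1 : (fun q : ℝ × ℝ => levelPoint μ K 0 q.2) = fun q => levelPoint μ K 0 (0 + L₂ q) := by funext q; simp [hL₂]
  have e2 : (fun q : ℝ × ℝ => levelPoint μ K ρ (ϑ + q.2)) = fun q => levelPoint μ K ρ (ϑ + L₂ q) := by funext q; simp [hL₂]
  have e3 : (fun q : ℝ × ℝ => levelPoint μ K e (q.1 + q.2)) = fun q => levelPoint μ K e (0 + L₁₂ q) := by funext q; simp [hL₁₂]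
  have hΦi : ∀ {x : ℝ}, |x| < r → ContDiff ℝ i (levelPoint μ K x) := fun hx => (contDiff_levelPoint_top hA hd hlo hhi hx).of_le (by exact_mod_cast le_top)
  have c1 : ContDiff ℝ i (fun q : ℝ × ℝ => levelPoint μ K 0 q.2) := (hΦi h0).comp contDiff_snd
  have c2 : ContDiff ℝ i (fun q : ℝ × ℝ => levelPoint μ K ρ (ϑ + q.2)) := (hΦi hρ).comp (contDiff_const.add contDiff_snd)
  have c3 : ContDiff ℝ i (fun q : ℝ × ℝ => levelPoint μ K e (q.1 + q.2)) := (hΦi he).comp (contDiff_fst.add contDiff_snd)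
  rw [show (fun q : ℝ × ℝ => levelPoint μ K 0 q.2 + levelPoint μ K ρ (ϑ + q.2) - levelPoint μ K e (q.1 + q.2)) =
      ((fun q : ℝ × ℝ => levelPoint μ K 0 q.2) + fun q : ℝ × ℝ => levelPoint μ K ρ (ϑ + q.2)) - fun q : ℝ × ℝ => levelPoint μ K e (q.1 + q.2) from rfl,
    iteratedFDeriv_sub_apply (f := (fun q : ℝ × ℝ => levelPoint μ K 0 q.2) + fun q : ℝ × ℝ => levelPoint μ K ρ (ϑ + q.2))
      (g := fun q : ℝ × ℝ => levelPoint μ K e (q.1 + q.2)) (c1.add c2).contDiffAt c3.contDiffAt,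
    iteratedFDeriv_add_apply (f := fun q : ℝ × ℝ => levelPoint μ K 0 q.2) (g := fun q : ℝ × ℝ => levelPoint μ K ρ (ϑ + q.2))
      c1.contDiffAt c2.contDiffAt]
  refine (norm_sub_le _ _).trans ((add_le_add_left (norm_add_le _ _) _).trans ?_)
  have b1 := norm_iteratedFDeriv_levelPoint_level_comp_affine_le hA hA20 hd hlo hhi hA₃ hA₄ hA₅ hA₆ h0 0 L₂ hi1 hi6 q
  have b2 := norm_iteratedFDeriv_levelPoint_level_comp_affine_le hA hA20 hd hlo hhi hA₃ hA₄ hA₅ hA₆ hρ ϑ L₂ hi1 hi6 q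
  have b3 := norm_iteratedFDeriv_levelPoint_level_comp_affine_le hA hA20 hd hlo hhi hA₃ hA₄ hA₅ hA₆ he 0 L₁₂ hi1 hi6 q
  rw [← e1] at b1; rw [← e2] at b2; rw [← e3] at b3
  have hD0 : 0 ≤ msD6 A₃ A₄ A₅ A₆ i := (norm_nonneg _).trans (norm_iteratedDeriv_levelPoint_le_six hA hA20 hd hlo hhi hA₃ hA₄ hA₅ hA₆ h0 hi1 hi6 0)
  have p2 : ‖L₂‖ ^ i ≤ 1 := pow_le_one₀ (norm_nonneg _) hn₂
  have p12 : ‖L₁₂‖ ^ i ≤ 2 ^ i := pow_le_pow_left₀ (norm_nonneg _) hn₁₂ i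
  nlinarith [mul_le_mul_of_nonneg_left p2 hD0, mul_le_mul_of_nonneg_left p12 hD0]

omit hA20 hA₃ hA₄ hA₅ hA₆ in
/-- `P_{ρ,e}` is `C^∞` on the plane. -/
theorem contDiff_pairConfigLevel {ρ e : ℝ} (hρ : |ρ| < r) (he : |e| < r) (ϑ : ℝ) :
    ContDiff ℝ ∞ (fun q : ℝ × ℝ => levelPoint μ K 0 q.2 + levelPoint μ K ρ (ϑ + q.2) - levelPoint μ K e (q.1 + q.2)) := by
  have h0 : |(0 : ℝ)| < r := by simpa using hr
  have hΦ : ∀ {x : ℝ}, |x| < r → ContDiff ℝ ∞ (levelPoint μ K x) := fun hx => contDiff_levelPoint_top hA hd hlo hhi hx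
  exact (((hΦ h0).comp contDiff_snd).add ((hΦ hρ).comp (contDiff_const.add contDiff_snd))).sub ((hΦ he).comp (contDiff_fst.add contDiff_snd))

/-- **`‖Dⁿ(e_K ∘ P_{ρ,e})(q)‖ ≤ n!·𝒦·Dⁿ`** whenever `‖Dⁱe_K‖ ≤ 𝒦` (`i ≤ n`) and `(2 + 2ⁱ)·msD6 i ≤ Dⁱ` (`1 ≤ i ≤ n ≤ 6`). -/
theorem norm_iteratedFDeriv_partnerBandLevel_plane_le {ρ e : ℝ} (hρ : |ρ| < r) (he : |e| < r) (ϑ : ℝ) {n : ℕ} (hn : n ≤ 6) {𝒦 : ℝ}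
    (hK : ∀ i, i ≤ n → ∀ p : Momentum, ‖iteratedFDeriv ℝ i (frameLevel μ K) p‖ ≤ 𝒦)
    {D : ℝ} (hDrow : ∀ i, 1 ≤ i → i ≤ n → (2 + 2 ^ i) * msD6 A₃ A₄ A₅ A₆ i ≤ D ^ i) (q : ℝ × ℝ) :
    ‖iteratedFDeriv ℝ n (fun q : ℝ × ℝ => frameLevel μ K (levelPoint μ K 0 q.2 + levelPoint μ K ρ (ϑ + q.2) - levelPoint μ K e (q.1 + q.2))) q‖ ≤
      n.factorial * 𝒦 * D ^ n := by
  have hP := contDiff_pairConfigLevel hA hd hr hlo hhi hρ he ϑ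
  have hfun : (fun q : ℝ × ℝ => frameLevel μ K (levelPoint μ K 0 q.2 + levelPoint μ K ρ (ϑ + q.2) - levelPoint μ K e (q.1 + q.2))) =
      frameLevel μ K ∘ fun q : ℝ × ℝ => levelPoint μ K 0 q.2 + levelPoint μ K ρ (ϑ + q.2) - levelPoint μ K e (q.1 + q.2) := rfl
  rw [hfun]
  exact norm_iteratedFDeriv_comp_le (EngineV8.contDiff_frameLevel μ K (n := ∞)) hP (by exact_mod_cast le_top) q
    (fun i hi => hK i hi _) (fun i hi1 hi => (norm_iteratedFDeriv_pairConfigLevel_le hA hA20 hd hr hlo hhi hA₃ hA₄ hA₅ hA₆ hρ he ϑ hi1 (hi.trans hn) q).trans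
      (hDrow i hi1 hi))

/-! ## §3 The uniform jet tables -/

/-- **BASE-ANGLE JET TABLE at every configuration**: `|∂ᵐ_ψ|_θ e_K(Φ(0,ψ) + Φ(ρ,ϑ+ψ) − Φ(e,φ+ψ))| ≤ m!·𝒦·Dᵐ` (`m ≤ 6`; `‖Dⁱe_K‖ ≤ 𝒦`, `i ≤ m`;
rows `(2 + 2ⁱ)·msD6 i ≤ Dⁱ`) — the `H₀` row of the transversal two-zero control. -/
theorem abs_iteratedDeriv_partnerBand_pp_base_le_table {m : ℕ} (hm : m ≤ 6) {𝒦 : ℝ}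
    (hK : ∀ i, i ≤ m → ∀ p : Momentum, ‖iteratedFDeriv ℝ i (frameLevel μ K) p‖ ≤ 𝒦)
    {D : ℝ} (hDrow : ∀ i, 1 ≤ i → i ≤ m → (2 + 2 ^ i) * msD6 A₃ A₄ A₅ A₆ i ≤ D ^ i)
    {ρ e : ℝ} (hρ : |ρ| < r) (he : |e| < r) (ϑ θ φ : ℝ) :
    |iteratedDeriv m (fun ψ : ℝ => frameLevel μ K (levelPoint μ K 0 ψ + levelPoint μ K ρ (ϑ + ψ) - levelPoint μ K e (φ + ψ))) θ| ≤
      m.factorial * 𝒦 * D ^ m := by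
  have hG : ContDiff ℝ ∞ (fun q : ℝ × ℝ => frameLevel μ K (levelPoint μ K 0 q.2 + levelPoint μ K ρ (ϑ + q.2) - levelPoint μ K e (q.1 + q.2))) :=
    (EngineV8.contDiff_frameLevel μ K (n := ∞)).comp (contDiff_pairConfigLevel hA hd hr hlo hhi hρ he ϑ)
  have hsec : (fun ψ : ℝ => frameLevel μ K (levelPoint μ K 0 ψ + levelPoint μ K ρ (ϑ + ψ) - levelPoint μ K e (φ + ψ))) =
      fun t : ℝ => (fun q : ℝ × ℝ => frameLevel μ K (levelPoint μ K 0 q.2 + levelPoint μ K ρ (ϑ + q.2) - levelPoint μ K e (q.1 + q.2))) (φ, t) := rfl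
  rw [hsec, ← Real.norm_eq_abs]
  exact (norm_iteratedDeriv_section_snd_le hG m φ θ).trans
    (norm_iteratedFDeriv_partnerBandLevel_plane_le hA hA20 hd hr hlo hhi hA₃ hA₄ hA₅ hA₆ hρ he ϑ hm hK hDrow (φ, θ))

/-- **FIRST MIXED DERIVATIVE TABLE at every configuration**: `|∂_φ ∂ᵐ_ψ|_θ e_K(Φ(0,ψ) + Φ(ρ,ϑ+ψ) − Φ(e,φ+ψ))| ≤ (m+1)!·𝒦·D^{m+1}` (`m ≤ 5`) — the `H₁` row. -/
theorem abs_deriv_iteratedDeriv_partnerBand_pp_base_le_table {m : ℕ} (hm : m ≤ 5) {𝒦 : ℝ}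
    (hK : ∀ i, i ≤ m + 1 → ∀ p : Momentum, ‖iteratedFDeriv ℝ i (frameLevel μ K) p‖ ≤ 𝒦)
    {D : ℝ} (hDrow : ∀ i, 1 ≤ i → i ≤ m + 1 → (2 + 2 ^ i) * msD6 A₃ A₄ A₅ A₆ i ≤ D ^ i)
    {ρ e : ℝ} (hρ : |ρ| < r) (he : |e| < r) (ϑ θ φ : ℝ) :
    |deriv (fun φ : ℝ => iteratedDeriv m (fun ψ : ℝ => frameLevel μ K (levelPoint μ K 0 ψ + levelPoint μ K ρ (ϑ + ψ) - levelPoint μ K e (φ + ψ))) θ) φ| ≤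
      (m + 1).factorial * 𝒦 * D ^ (m + 1) := by
  have hG : ContDiff ℝ ∞ (fun q : ℝ × ℝ => frameLevel μ K (levelPoint μ K 0 q.2 + levelPoint μ K ρ (ϑ + q.2) - levelPoint μ K e (q.1 + q.2))) :=
    (EngineV8.contDiff_frameLevel μ K (n := ∞)).comp (contDiff_pairConfigLevel hA hd hr hlo hhi hρ he ϑ)
  have hsec : (fun φ : ℝ => iteratedDeriv m (fun ψ : ℝ => frameLevel μ K (levelPoint μ K 0 ψ + levelPoint μ K ρ (ϑ + ψ) - levelPoint μ K e (φ + ψ))) θ) =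
      fun s : ℝ => iteratedDeriv m (fun t : ℝ =>
        (fun q : ℝ × ℝ => frameLevel μ K (levelPoint μ K 0 q.2 + levelPoint μ K ρ (ϑ + q.2) - levelPoint μ K e (q.1 + q.2))) (s, t)) θ := rfl
  rw [hsec, ← Real.norm_eq_abs]
  exact (norm_deriv_iteratedDeriv_section_le hG m φ θ).trans
    (norm_iteratedFDeriv_partnerBandLevel_plane_le hA hA20 hd hr hlo hhi hA₃ hA₄ hA₅ hA₆ hρ he ϑ (by omega) hK hDrow (φ, θ))

end Sizes

end Summit.HubbardSuperconductivity.HubbardSuperconductivity.Theorems.C4a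

end
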